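import Mathlib
import HarnessLib
import Summits.HubbardSuperconductivity.HubbardSuperconductivity.Theorems.KLProgrammeC4aValueBridgePV

/-!
# Route `KLProgramme` — crux C4a, value layer (L3-val): the principal-value bound at fixed level, INTEGRATED — `‖∫_{(−π,π)} DB(S_σ(φ))[W(φ)] dφ‖ ≤ valuePVConst`

Cell `gate-hubbard-kl`, lane hubbard-kl-k3c3-p3 (g14); helper for stub (C) `stub_twoLeg_curvature` of `KLRegimeEngineV17F2` (stmt-HubbardSuperconductivity-20437),
`k = 0` VALUE clause (located risk #12 «(C)-VALUE-K0»; (L3-val) input (ii) of HOME/hubbard-kl-c4a-1/C4A-PLAN.md §22.3).  Third file of the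
«(L3-val)-EVEN-BRIDGE» bundle: `…C4aValueBridgeGeometry` (chart geometry) → `…C4aValueBridgePV` (constants, weight, the paired pointwise bound) → THIS
(symmetrisation + a.e. domination by the Cauchy kernel + integration) → `…C4aValueBridge` (assembly into the `hd` of `norm_sum_tubeTadpoles_le_of_oddDiff`).

THE THEOREM (`norm_setIntegral_fderiv_pairSumPath_le`).  `B : Momentum → ℂ` of class `C²`, even, `‖DB(p)‖ ≤ cb₁(max(c′‖p‖,Λ))⁻¹`, `‖D²B(p)‖ ≤ cb₂(max(c′‖p‖,Λ))⁻²`;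
`|s₀|, |σ| < r`; `θ` arbitrary.  Then
  `‖∫_{φ∈(−π,π)} DB(S_{σ,π+φ,θ}(0))[J(s₀,π+φ+θ) • ∂_σS_{σ,π+φ,θ}(0)] dφ‖ ≤ valuePVConst A A₃ A₄ r cb₁ cb₂ c′`
— a constant free of `σ`, `s₀`, `θ`, `μ`, `K` (beyond its sizes) and, above all, of `Λ`.  Proof: `∫f = ½∫(f(φ)+f(−φ))`; for a.e. `φ` (all `φ ≠ 0`) the pair is
dominated by `A₀ + A₁·a/(φ²+a²)` with `a = valueBridgeKappa·|σ|` (near core: direct bound `2cb₁W₀/(c′c|σ|) ≤ A₁-part`; middle window: `…PV.norm_fderiv_pair_le_of_window`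
with `|σ|/φ² ≤ (2/κ₀)·a/(φ²+a²)`; far: direct bound `≤ A₀`), and `∫ a/(φ²+a²) ≤ π`.

Pure real analysis on the tree's chart objects; nothing about the Hubbard model's sizes; nothing asserts superconductivity.
References: BGM 2006 §2.4 (2.36) [cite: BenfattoGiulianiMastropietro2006]; FST II CPAM 51 (1998) §3.
-/

noncomputable section

namespace Summit.HubbardSuperconductivity.HubbardSuperconductivity.Theorems.C4a

set_option linter.dupNamespace false -- summit = problem name (single-conjunct summit), D-0017

open Real Set MeasureTheory Filter
open scoped ContDiff Topology
open Literature.MathematicalPhysics.QuantumLattice Literature.MathematicalPhysics.QuantumLattice.BandSectorCounting Literature.Probability.LatticeModels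
open Summit.HubbardSuperconductivity.HubbardSuperconductivity.Theorems.KLRegimeSplit
open Summit.HubbardSuperconductivity.HubbardSuperconductivity.Theorems.DispersionFlow
open Summit.HubbardSuperconductivity.HubbardSuperconductivity.Theorems.PerturbedFermiCurve

/-! ## §1 Two integration facts -/

/-- **Symmetrisation on the window**: `∫_{(−π,π)} f = ½ ∫_{(−π,π)} (f(φ) + f(−φ)) dφ`. -/
theorem setIntegral_Ioo_eq_half_symm {E' : Type*} [NormedAddCommGroup E'] [NormedSpace ℝ E'] {f : ℝ → E'} (hf : IntegrableOn f (Ioo (-π) π))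
    (hf' : IntegrableOn (fun φ => f (-φ)) (Ioo (-π) π)) :
    ∫ φ in Ioo (-π) π, f φ = (1 / 2 : ℝ) • ∫ φ in Ioo (-π) π, (f φ + f (-φ)) := by
  rw [integral_add hf hf', setIntegral_Ioo_symm_comp_neg π f, ← two_smul ℝ, smul_smul]
  norm_num

/-- The Cauchy kernel with parameter `a ≥ 0` is integrable on the window and its integral is at most `π` (for `a = 0` it vanishes identically). -/
theorem cauchyKernel_integrableOn_and_le {a : ℝ} (ha : 0 ≤ a) :
    IntegrableOn (fun φ : ℝ => a / (φ ^ 2 + a ^ 2)) (Ioo (-π) π) ∧ ∫ φ in Ioo (-π) π, a / (φ ^ 2 + a ^ 2) ≤ π := by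
  rcases ha.eq_or_lt with h | h
  · rw [← h]
    simp only [zero_div, integral_zero]
    exact ⟨integrableOn_zero, Real.pi_pos.le⟩
  · have hcont : Continuous fun φ : ℝ => a / (φ ^ 2 + a ^ 2) :=
      continuous_const.div (by fun_prop) fun φ => by positivity
    exact ⟨(hcont.continuousOn.integrableOn_Icc (a := -π) (b := π)).mono_set Ioo_subset_Icc_self, setIntegral_cauchyKernel_le h⟩

section Sizes

variable {K : TrigPolyC4v} {A : ℝ} (hA : ∀ p : Momentum, ∀ j ≤ 2, ‖iteratedFDeriv ℝ j (frameShift K) p‖ ≤ A) (hA20 : A ≤ 1 / 20)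
  (hd : klCurveD ≤ (bandBounds (show (-4 : ℝ) < -1.1 by norm_num) (show (-1.1 : ℝ) ≤ -0.1 by norm_num)
    (show (-0.1 : ℝ) < 0 by norm_num)).Dtmin - 2 * A)
  {μ r : ℝ} (hr : 0 < r) (hlo : (-1.1 : ℝ) < μ - r - A) (hhi : μ + r + A < -0.1)
  {A₃ A₄ : ℝ} (hA₃ : ∀ p : Momentum, ‖iteratedFDeriv ℝ 3 (frameShift K) p‖ ≤ A₃)
  (hA₄ : ∀ p : Momentum, ‖iteratedFDeriv ℝ 4 (frameShift K) p‖ ≤ A₄)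
include hA hA20 hd hr hlo hhi hA₃ hA₄

/-! ## §2 Continuity of the integrand -/

omit hA20 hA₃ hA₄ hr in
/-- The relative-angle section `φ ↦ S_{σ,π+φ,θ}(0)` is continuous. -/
theorem continuous_pairSumPath_pi_add {σ : ℝ} (hσ : |σ| < r) (θ : ℝ) : Continuous fun φ : ℝ => pairSumPath μ K σ (π + φ) θ 0 := by
  set B := bandBounds (show (-4 : ℝ) < -1.1 by norm_num) (show (-1.1 : ℝ) ≤ -0.1 by norm_num) (show (-0.1 : ℝ) < 0 by norm_num) with hBdef
  have hADt : 2 * A < B.Dtmin := by have := klCurveD_pos; linarith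
  have h := ((contDiff_levelPoint_angle B hA hADt hlo hhi hσ (m := 0)).continuous).comp (by fun_prop : Continuous fun φ : ℝ => π + φ + θ)
  simp only [pairSumPath_apply_zero]
  exact continuous_const.add (by simpa [Function.comp_def, add_assoc, add_comm, add_left_comm] using h)

omit hA20 hA₃ hA₄ hr in
/-- **The PV integrand is continuous** in the relative angle: `φ ↦ DB(S_σ(φ))[J(s₀,π+φ+θ) • ∂_σS_σ(φ)]` for `B ∈ C¹`. -/
theorem continuous_fderiv_pairSumPath_apply_weight {Bf : Momentum → ℂ} (hB : ContDiff ℝ 1 Bf) {s₀ σ : ℝ} (hs₀ : |s₀| < r) (hσ : |σ| < r) (θ : ℝ) :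
    Continuous fun φ : ℝ => (fderiv ℝ Bf (pairSumPath μ K σ (π + φ) θ 0))
      (levelChartJac μ K (s₀, π + φ + θ) •
        (WithLp.toLp 2 (deriv (fun m : ℝ => perturbedFermiRadius (fun k : Fin 2 → ℝ => -K.eval k) m (π + φ + θ)) (μ + σ) • dir (π + φ + θ)) :
          Momentum)) := by
  have hS := continuous_pairSumPath_pi_add hA hd hlo hhi hσ θ
  have hDB : Continuous fun φ : ℝ => fderiv ℝ Bf (pairSumPath μ K σ (π + φ) θ 0) := (hB.continuous_fderiv (by norm_num)).comp hS
  have hW := (continuous_jac_smul_levelVel hA hd hlo hhi hs₀ hσ).comp (by fun_prop : Continuous fun φ : ℝ => π + φ + θ)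
  exact hDB.clm_apply (by simpa [Function.comp_def] using hW)

/-! ## §3 The theorem -/

/-- **THE PRINCIPAL-VALUE BOUND AT FIXED LEVEL.**  `B : Momentum → ℂ` of class `C²`, EVEN, with `‖DB(p)‖ ≤ cb₁·(max(c′‖p‖,Λ))⁻¹` and
`‖D²B(p)‖ ≤ cb₂·(max(c′‖p‖,Λ))⁻²` (`0 < c′`, `0 < Λ`, `0 ≤ cb₁, cb₂`); tube levels `|s₀|, |σ| < r`; any base angle `θ`.  Then
`‖∫_{φ∈(−π,π)} DB(S_{σ,π+φ,θ}(0))[J(s₀,π+φ+θ) • toLp(∂_μu(σ,π+φ+θ)•dir(π+φ+θ))] dφ‖ ≤ valuePVConst A A₃ A₄ r cb₁ cb₂ c′` — INDEPENDENT OF `Λ`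
(and of `σ`, `s₀`, `θ`). [cite: BenfattoGiulianiMastropietro2006, §2.4 (2.36)] -/
theorem norm_setIntegral_fderiv_pairSumPath_le {Bf : Momentum → ℂ} (hB : ContDiff ℝ 2 Bf) (heven : ∀ p, Bf (-p) = Bf p) {cb₁ cb₂ c' Λ : ℝ}
    (hc' : 0 < c') (hΛ : 0 < Λ) (hcb₁ : 0 ≤ cb₁) (hcb₂ : 0 ≤ cb₂) (hD1 : ∀ p, ‖fderiv ℝ Bf p‖ ≤ cb₁ * (max (c' * ‖p‖) Λ)⁻¹)
    (hD2 : ∀ p, ‖iteratedFDeriv ℝ 2 Bf p‖ ≤ cb₂ * ((max (c' * ‖p‖) Λ) ^ 2)⁻¹) {s₀ σ : ℝ} (hs₀ : |s₀| < r) (hσ : |σ| < r) (θ : ℝ) :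
    ‖∫ φ in Ioo (-π) π, (fderiv ℝ Bf (pairSumPath μ K σ (π + φ) θ 0))
        (levelChartJac μ K (s₀, π + φ + θ) •
          (WithLp.toLp 2 (deriv (fun m : ℝ => perturbedFermiRadius (fun k : Fin 2 → ℝ => -K.eval k) m (π + φ + θ)) (μ + σ) • dir (π + φ + θ)) :
            Momentum))‖ ≤
      valuePVConst A A₃ A₄ r cb₁ cb₂ c' := by
  set B := bandBounds (show (-4 : ℝ) < -1.1 by norm_num) (show (-1.1 : ℝ) ≤ -0.1 by norm_num) (show (-0.1 : ℝ) < 0 by norm_num) with hBdef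
  have hADt : 2 * A < B.Dtmin := by have := klCurveD_pos; linarith
  have hDt : 0 < B.Dtmin - 2 * A := by linarith
  set c := pairSumLowerConst r with hcdef
  have hc : 0 < c := pairSumLowerConst_pos hr
  have h0r : |(0 : ℝ)| < r := by simpa using hr
  have hm0 : 0 ≤ msD A₃ A₄ 2 :=
    le_trans (norm_nonneg _) (norm_iteratedDeriv_levelPoint_le hA hA20 hd hlo hhi hA₃ hA₄ h0r (i := 2) (by norm_num) (by norm_num) θ)
  -- the weight and the integrand
  set W : ℝ → Momentum := fun φ => levelChartJac μ K (s₀, π + φ + θ) •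
    (WithLp.toLp 2 (deriv (fun m : ℝ => perturbedFermiRadius (fun k : Fin 2 → ℝ => -K.eval k) m (π + φ + θ)) (μ + σ) • dir (π + φ + θ)) : Momentum)
    with hWdef
  set f : ℝ → ℂ := fun φ => (fderiv ℝ Bf (pairSumPath μ K σ (π + φ) θ 0)) (W φ) with hfdef
  -- constants
  set W₀ := valueBridgeW0 A with hW₀def
  set LW := valueBridgeLW A A₃ with hLWdef
  set κ₀ := valueBridgeKappa A r with hκ₀def
  set φ₀ := valueBridgePhi0 A₃ A₄ r with hφ₀def
  have hW₀ : 0 ≤ W₀ := valueBridgeW0_nonneg A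
  have hκ₀ : 0 < κ₀ := by rw [hκ₀def, valueBridgeKappa, ← hBdef, ← hcdef]; positivity
  have hφ₀ : 0 < φ₀ := by rw [hφ₀def, valueBridgePhi0, ← hcdef]; positivity
  have hWle : ∀ φ, ‖W φ‖ ≤ W₀ := fun φ => norm_jac_smul_levelVel_le hA hd hlo hhi hs₀ hσ (π + φ + θ)
  have hWlip : ∀ φ φ', ‖W φ - W φ'‖ ≤ LW * |φ - φ'| := fun φ φ' => by
    have h := norm_jac_smul_levelVel_sub_le hA hd hlo hhi (A₃ := A₃) hs₀ hσ (π + φ + θ) (π + φ' + θ)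
    rwa [show π + φ + θ - (π + φ' + θ) = φ - φ' by ring] at h
  have hLW : 0 ≤ LW := by
    have h := hWlip 1 0
    rw [sub_zero, abs_one, mul_one] at h
    exact (norm_nonneg _).trans h
  set a := κ₀ * |σ| with hadef
  have ha : 0 ≤ a := by positivity
  set A₀ := 2 * cb₁ * W₀ / (c' * c * φ₀) + 2 * cb₁ * LW / (c' * c) + 8 * cb₂ * W₀ * msD A₃ A₄ 2 / (c' * c) ^ 2 with hA₀def
  set A₁ := 4 * κ₀ * cb₁ * W₀ / (c' * c) + 16 * cb₂ * W₀ / ((c' * c) ^ 2 * (B.Dtmin - 2 * A) * κ₀) with hA₁def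
  have hA₀ : 0 ≤ A₀ := by positivity
  have hA₁ : 0 ≤ A₁ := by positivity
  have hconst : valuePVConst A A₃ A₄ r cb₁ cb₂ c' = π * A₀ + π / 2 * A₁ := by
    rw [valuePVConst, hA₀def, hA₁def]
  -- direct bound on `f`
  have hf_le : ∀ φ ∈ Ioo (-π) π, ∀ ℓ, ℓ ≤ c * (|σ| + |φ|) → 0 < c' * ℓ → ‖f φ‖ ≤ cb₁ * W₀ / (c' * ℓ) := by
    intro φ hφ ℓ hℓ hℓ0
    have hS := norm_pairSumPath_pi_add_ge hA hA20 hd hr hlo hhi hA₃ hA₄ hσ hφ θ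
    rw [← hcdef] at hS
    have hDB : ‖fderiv ℝ Bf (pairSumPath μ K σ (π + φ) θ 0)‖ ≤ cb₁ * (max (c' * ℓ) Λ)⁻¹ :=
      norm_fderiv_le_of_majorant hΛ hcb₁ hD1 hc'.le (hℓ.trans hS)
    calc ‖f φ‖ ≤ ‖fderiv ℝ Bf (pairSumPath μ K σ (π + φ) θ 0)‖ * ‖W φ‖ := ContinuousLinearMap.le_opNorm _ _
      _ ≤ cb₁ * (max (c' * ℓ) Λ)⁻¹ * W₀ := mul_le_mul hDB (hWle φ) (norm_nonneg _) (by positivity)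
      _ ≤ cb₁ * (c' * ℓ)⁻¹ * W₀ := mul_le_mul_of_nonneg_right (mul_le_mul_of_nonneg_left (inv_anti₀ hℓ0 (le_max_left _ _)) hcb₁) hW₀
      _ = cb₁ * W₀ / (c' * ℓ) := by ring
  -- a.e. domination of the symmetrised integrand
  have hdom : ∀ φ ∈ Ioo (-π) π, φ ≠ 0 → ‖f φ + f (-φ)‖ ≤ A₀ + A₁ * (a / (φ ^ 2 + a ^ 2)) := by
    intro φ hφ hφ0
    have hφ' : -φ ∈ Ioo (-π) π := ⟨by linarith [hφ.2], by linarith [hφ.1]⟩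
    have hφabs : 0 < |φ| := abs_pos.2 hφ0
    have hker0 : 0 ≤ a / (φ ^ 2 + a ^ 2) := by positivity
    rcases le_or_gt |φ| a with hnear | hmid
    · -- near core: `|φ| ≤ a`, hence `σ ≠ 0`, `a > 0`
      have ha0 : 0 < a := hφabs.trans_le hnear
      have hσ0 : 0 < |σ| := by
        rcases (abs_nonneg σ).eq_or_lt with h | h
        · exfalso; rw [hadef, ← h, mul_zero] at ha0; exact lt_irrefl _ ha0
        · exact h
      have hb : ∀ ψ ∈ Ioo (-π) π, ‖f ψ‖ ≤ cb₁ * W₀ / (c' * (c * |σ|)) := fun ψ hψ =>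
        hf_le ψ hψ (c * |σ|) (mul_le_mul_of_nonneg_left (le_add_of_nonneg_right (abs_nonneg ψ)) hc.le) (mul_pos hc' (mul_pos hc hσ0))
      have hsum : ‖f φ + f (-φ)‖ ≤ 2 * (cb₁ * W₀ / (c' * (c * |σ|))) :=
        (norm_add_le _ _).trans (by linarith [hb φ hφ, hb (-φ) hφ'])
      -- `2cb₁W₀/(c′c|σ|) = (4κ₀cb₁W₀/(c′c))·(1/(2a)) ≤ A₁·a/(φ²+a²)`
      have hk := inv_le_cauchyKernel_of_abs_le ha0 hnear
      have hrew : 2 * (cb₁ * W₀ / (c' * (c * |σ|))) = 4 * κ₀ * cb₁ * W₀ / (c' * c) * (1 / (2 * a)) := by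
        rw [hadef]; field_simp; ring
      calc ‖f φ + f (-φ)‖ ≤ 4 * κ₀ * cb₁ * W₀ / (c' * c) * (1 / (2 * a)) := hrew ▸ hsum
        _ ≤ 4 * κ₀ * cb₁ * W₀ / (c' * c) * (a / (φ ^ 2 + a ^ 2)) := mul_le_mul_of_nonneg_left hk (by positivity)
        _ ≤ A₁ * (a / (φ ^ 2 + a ^ 2)) := by
            refine mul_le_mul_of_nonneg_right ?_ hker0
            rw [hA₁def]; exact le_add_of_nonneg_right (by positivity)
        _ ≤ A₀ + A₁ * (a / (φ ^ 2 + a ^ 2)) := le_add_of_nonneg_left hA₀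
    rcases le_or_gt |φ| φ₀ with hmid' | hfar
    · -- middle window: the paired bound
      have hpair := norm_fderiv_pair_le_of_window hA hA20 hd hr hlo hhi hA₃ hA₄ hB heven hc' hΛ hcb₁ hcb₂ hD1 hD2 hσ θ (W := W) hWle hWlip hφ
        hφ0 (by rw [← hκ₀def]; exact hmid.le) (by rw [← hφ₀def]; exact hmid')
      rw [← hBdef, ← hcdef] at hpair
      -- `|σ|/φ² ≤ (2/κ₀)·a/(φ²+a²)`
      have htail : |σ| / φ ^ 2 ≤ 2 / κ₀ * (a / (φ ^ 2 + a ^ 2)) := by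
        rcases ha.eq_or_lt with h0 | h0
        · have : |σ| = 0 := by
            have : κ₀ * |σ| = 0 := by rw [← hadef, ← h0]
            rcases mul_eq_zero.1 this with h | h
            · exact absurd h hκ₀.ne'
            · exact h
          rw [this, zero_div]; positivity
        · have hk := div_sq_le_cauchyKernel_of_le_abs h0 hmid.le
          calc |σ| / φ ^ 2 = 2 / κ₀ * (a / (2 * φ ^ 2)) := by rw [hadef]; field_simp
            _ ≤ 2 / κ₀ * (a / (φ ^ 2 + a ^ 2)) := mul_le_mul_of_nonneg_left hk (by positivity)
      have hφ2 : 0 < φ ^ 2 := by positivity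
      calc ‖f φ + f (-φ)‖ ≤ 4 * cb₂ * W₀ / (c' * c) ^ 2 * ((2 * |σ| / (B.Dtmin - 2 * A) + 2 * msD A₃ A₄ 2 * φ ^ 2) / φ ^ 2) +
            2 * cb₁ * LW / (c' * c) := hpair
        _ = 8 * cb₂ * W₀ / ((c' * c) ^ 2 * (B.Dtmin - 2 * A)) * (|σ| / φ ^ 2) +
              (8 * cb₂ * W₀ * msD A₃ A₄ 2 / (c' * c) ^ 2 + 2 * cb₁ * LW / (c' * c)) := by field_simp; ring
        _ ≤ 8 * cb₂ * W₀ / ((c' * c) ^ 2 * (B.Dtmin - 2 * A)) * (2 / κ₀ * (a / (φ ^ 2 + a ^ 2))) +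
              (8 * cb₂ * W₀ * msD A₃ A₄ 2 / (c' * c) ^ 2 + 2 * cb₁ * LW / (c' * c)) := by gcongr
        _ ≤ A₀ + A₁ * (a / (φ ^ 2 + a ^ 2)) := by
            rw [hA₀def, hA₁def]
            have h1 : 0 ≤ 2 * cb₁ * W₀ / (c' * c * φ₀) := by positivity
            have h2 : 0 ≤ 4 * κ₀ * cb₁ * W₀ / (c' * c) * (a / (φ ^ 2 + a ^ 2)) := by positivity
            have h3 : 8 * cb₂ * W₀ / ((c' * c) ^ 2 * (B.Dtmin - 2 * A)) * (2 / κ₀ * (a / (φ ^ 2 + a ^ 2))) =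
                16 * cb₂ * W₀ / ((c' * c) ^ 2 * (B.Dtmin - 2 * A) * κ₀) * (a / (φ ^ 2 + a ^ 2)) := by field_simp; ring
            rw [h3, add_mul]; linarith
    · -- far: `|φ| > φ₀`
      have hb : ∀ ψ ∈ Ioo (-π) π, φ₀ ≤ |ψ| → ‖f ψ‖ ≤ cb₁ * W₀ / (c' * (c * φ₀)) := fun ψ hψ hψ0 =>
        hf_le ψ hψ (c * φ₀) (mul_le_mul_of_nonneg_left (le_add_of_nonneg_of_le (abs_nonneg σ) hψ0) hc.le) (mul_pos hc' (mul_pos hc hφ₀))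
      have hφ0' : φ₀ ≤ |(-φ)| := by rw [abs_neg]; exact hfar.le
      calc ‖f φ + f (-φ)‖ ≤ cb₁ * W₀ / (c' * (c * φ₀)) + cb₁ * W₀ / (c' * (c * φ₀)) :=
            (norm_add_le _ _).trans (add_le_add (hb φ hφ hfar.le) (hb (-φ) hφ' hφ0'))
        _ = 2 * cb₁ * W₀ / (c' * c * φ₀) := by ring
        _ ≤ A₀ := by rw [hA₀def]; exact le_add_of_nonneg_right (by positivity) |>.trans (le_add_of_nonneg_right (by positivity))
        _ ≤ A₀ + A₁ * (a / (φ ^ 2 + a ^ 2)) := le_add_of_nonneg_right (by positivity)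
  -- integrability
  have hcont := continuous_fderiv_pairSumPath_apply_weight hA hd hlo hhi (hB.of_le (by norm_num)) hs₀ hσ θ
  have hfcont : Continuous f := hcont
  have hfint : IntegrableOn f (Ioo (-π) π) := (hfcont.continuousOn.integrableOn_Icc (a := -π) (b := π)).mono_set Ioo_subset_Icc_self
  have hfint' : IntegrableOn (fun φ => f (-φ)) (Ioo (-π) π) :=
    ((hfcont.comp continuous_neg).continuousOn.integrableOn_Icc (a := -π) (b := π)).mono_set Ioo_subset_Icc_self
  obtain ⟨hkint, hkle⟩ := cauchyKernel_integrableOn_and_le (a := a) ha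
  have hmint : IntegrableOn (fun φ : ℝ => A₀ + A₁ * (a / (φ ^ 2 + a ^ 2))) (Ioo (-π) π) :=
    (continuous_const.integrableOn_Icc (a := -π) (b := π) |>.mono_set Ioo_subset_Icc_self).add (hkint.const_mul A₁)
  -- the a.e. form of the domination
  have hae : ∀ᵐ φ ∂(volume.restrict (Ioo (-π) π)), ‖f φ + f (-φ)‖ ≤ A₀ + A₁ * (a / (φ ^ 2 + a ^ 2)) := by
    have h0 : ∀ᵐ φ : ℝ, φ ≠ 0 := by
      have : (volume : Measure ℝ) {φ : ℝ | ¬ φ ≠ 0} = 0 := by simp [measure_singleton]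
      exact this
    filter_upwards [ae_restrict_mem measurableSet_Ioo, ae_restrict_of_ae h0] with φ hφ hφ0
    exact hdom φ hφ hφ0
  -- assemble
  have hsym := setIntegral_Ioo_eq_half_symm hfint hfint'
  have hI : ‖∫ φ in Ioo (-π) π, (f φ + f (-φ))‖ ≤ 2 * π * A₀ + π * A₁ := by
    calc ‖∫ φ in Ioo (-π) π, (f φ + f (-φ))‖ ≤ ∫ φ in Ioo (-π) π, ‖f φ + f (-φ)‖ := norm_integral_le_integral_norm _
      _ ≤ ∫ φ in Ioo (-π) π, (A₀ + A₁ * (a / (φ ^ 2 + a ^ 2))) := integral_mono_ae (hfint.add hfint').norm hmint hae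
      _ = A₀ * (2 * π) + A₁ * ∫ φ in Ioo (-π) π, a / (φ ^ 2 + a ^ 2) := by
          rw [integral_add _ (hkint.const_mul A₁), integral_const_mul, setIntegral_const]
          · rw [smul_eq_mul, Real.volume_real_Ioo_of_le (by linarith [Real.pi_pos])]; ring
          · exact continuous_const.integrableOn_Icc (a := -π) (b := π) |>.mono_set Ioo_subset_Icc_self
      _ ≤ A₀ * (2 * π) + A₁ * π := by gcongr
      _ = 2 * π * A₀ + π * A₁ := by ring
  show ‖∫ φ in Ioo (-π) π, f φ‖ ≤ valuePVConst A A₃ A₄ r cb₁ cb₂ c'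
  rw [hsym, norm_smul, Real.norm_eq_abs, abs_of_pos (by norm_num : (0 : ℝ) < 1 / 2), hconst]
  linarith

end Sizes

end Summit.HubbardSuperconductivity.HubbardSuperconductivity.Theorems.C4a

end
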